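import Summits.AtomisticToContinuum.HydrodynamicLimit.Theorems.JParityClosureEvenStressEnskogRung0Closure
import Literature.MathematicalPhysics.KineticTheory.CollisionTubeVarianceRung0Window
import Literature.MathematicalPhysics.StatisticalMechanics.HardSphereContactTheoremProofs
import HarnessLib

/-!
# (P-c) · rung 0 of `EvenStressEnskog` from the WINDOWED plateau (`stub_rungZero_of_plateauWindow`, here
# `rungZero_of_plateauWindow`; crux line `liouville-continuity-pins-universal-contact-value`, `JParityClosure.EvenStressEnskog`,
# stmt-AtomisticToContinuum-13079)

The landed rung-0 closure `EvenStressEnskog_rung0_of_plateau_contact` (`…Theorems.JParityClosureEvenStressEnskogRung0Closure`)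
takes two static inputs: the canonical contact theorem — now the tree theorem `HardSphereContactTheorem_holds` — and the
UNWINDOWED decorrelation plateau (relative asymptotic independence `|Cov| ≤ ζ vol(T) vol(T′)` of two disjoint decorated dimers
`h(x_i)𝟙_T(x_j − x_i)`, `h′(x_k)𝟙_{T′}(x_l − x_k)` under `posGibbsMeasure 1 ε_N (N+1)`, for ALL measurable `T, T′`).  A cluster
expansion only delivers the WINDOWED plateau (`T, T′ ⊆ {d | d(d, 0) ≤ C ε_N}`, `N ≥ N₀(σ, C, ζ)`), and that suffices: the plateau
enters the chain `variance_decoratedPairSum_le → variance_prod_decoratedTubeSum_le → variance_tubeStat_rung0_le →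
stub_tubeVarianceRung0_of_plateau2` only through the layer cake of the velocity-averaged tube mark, supported in the near-contact
shell `{ε_N < ‖reprSym d‖ ≤ ε_N(1 + 2Lκ)} ⊆ {d(d, 0) ≤ (1 + 2Lκ) ε_N}`, and the chain fixes `L, κ` before `N₀`.  The windowed
Literature links are `variance_decoratedPairSum_le_window` (`HardSphereDecoratedPairSumVarianceWindow`) and
`variance_prod_decoratedTubeSum_le_window`, `variance_tubeStat_rung0_le_window` (`CollisionTubeVarianceRung0Window`); here:

* `tubeVarianceRung0_of_plateauWindow` — the static tube variance (hA)₀ from the windowed plateau (proof of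
  `stub_tubeVarianceRung0_of_plateau2` with the plateau instantiated at `C = 1 + 2Lκ`);
* `rungZero_of_plateauWindow` — the registered stub: windowed plateau ⇒ `EvenStressEnskog` at constant profiles.

References: H. Spohn, *Large Scale Dynamics of Interacting Particles* (1991), Part I §2.3; D. Ruelle, *Statistical Mechanics:
Rigorous Results* (1969), §4.2.
-/

noncomputable section

open MeasureTheory ProbabilityTheory Set Filter Topology
open scoped ENNReal

namespace Summit.AtomisticToContinuum.HydrodynamicLimit.Theorems.EvenStressEnskog

open Literature.Analysis.FluidPDE Literature.MathematicalPhysics.KineticTheory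

/-- **The static tube variance (hA)₀ from the WINDOWED plateau** (as `stub_tubeVarianceRung0_of_plateau2`, whose plateau
hypothesis is unwindowed): the windowed plateau — relative asymptotic independence of two disjoint decorated dimers under the
activity-`1` canonical configurational measure for displacement sets inside the contact window `{d | d(d, 0) ≤ C ε_N}`,
`N ≥ N₀(σ, C, ζ)` — implies the static tube-variance input of `fixedTimeVariance_rung0_of_static`.  The chain fixes `L, κ`
before `N₀`, so the plateau is instantiated at the window `C = 1 + 2Lκ`, which contains the near-contact shell
`{ε_N < ‖reprSym d‖ ≤ ε_N (1 + 2Lκ)}` carrying the tube marks (`variance_tubeStat_rung0_le_window`); otherwise the proof of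
`stub_tubeVarianceRung0_of_plateau2` verbatim. [folklore] -/
theorem tubeVarianceRung0_of_plateauWindow :
    (∃ σ₁ : ℝ, 0 < σ₁ ∧ ∀ σ : ℝ, 0 < σ → σ < σ₁ → ∀ C : ℝ, 1 ≤ C → ∀ ζ : ℝ, 0 < ζ → ∃ N₀ : ℕ, ∀ N : ℕ, N₀ ≤ N →
      ∀ i j k l : Fin (N + 1), i ≠ j → i ≠ k → i ≠ l → j ≠ k → j ≠ l → k ≠ l →
      ∀ (h h' : T3 → ℝ), Measurable h → Measurable h' → (∀ y, |h y| ≤ 1) → (∀ y, |h' y| ≤ 1) →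
      ∀ T T' : Set T3, MeasurableSet T → MeasurableSet T' →
      T ⊆ {d | Torus.euclidDist d 0 ≤ C * hsDiameter σ N} → T' ⊆ {d | Torus.euclidDist d 0 ≤ C * hsDiameter σ N} →
      |(∫ x, h (x i) * T.indicator (fun _ => (1 : ℝ)) (x j - x i) * (h' (x k) * T'.indicator (fun _ => (1 : ℝ)) (x l - x k))
          ∂posGibbsMeasure (fun _ : T3 => (1 : ℝ)) (hsDiameter σ N) (N + 1)) -
        (∫ x, h (x i) * T.indicator (fun _ => (1 : ℝ)) (x j - x i)
          ∂posGibbsMeasure (fun _ : T3 => (1 : ℝ)) (hsDiameter σ N) (N + 1)) *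
        (∫ x, h' (x k) * T'.indicator (fun _ => (1 : ℝ)) (x l - x k)
          ∂posGibbsMeasure (fun _ : T3 => (1 : ℝ)) (hsDiameter σ N) (N + 1))|
        ≤ ζ * (volume T).toReal * (volume T').toReal) →
    ∃ η₀ : ℝ, 0 < η₀ ∧ ∀ (a θ : ℝ) (u : V3), 0 < a → 0 < θ → ∃ σ₀ : ℝ, 0 < σ₀ ∧ ∀ σ : ℝ, 0 < σ → σ < σ₀ →
      ∀ Φ : (N : ℕ) → HardSphereFlow (Torus.geometry (Fin 3)) (hsDiameter σ N) (N + 1),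
      ∀ τ : ℝ, 0 < τ → ∀ χ : ℝ × UnitAddTorus (Fin 3) → ℝ, Continuous χ → ∀ g : ℝ → ℝ, Continuous g →
      (∀ a', η₀ ≤ a' → g a' = 0) → ∀ ς : ℝ, 0 < ς → ∃ r₀ : ℝ, 0 < r₀ ∧ ∀ r : ℝ, 0 < r → r < r₀ →
      ∀ L κ : ℝ, 1 ≤ L → 0 < κ → κ ≤ 1 → ∃ N₀ : ℕ, ∀ N : ℕ, N₀ ≤ N → ∀ k l : Fin 3, ∀ t ∈ Set.Icc (0 : ℝ) τ,
        ProbabilityTheory.variance (fun z => tubeStat σ N χ g (evenMarkTrunc k l L) r r 1 κ t z)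
          (localGibbsLaw σ (fun _ => a) (fun _ => u) (fun _ => θ) N (Φ N)) ≤ ς := by
  intro hPl
  obtain ⟨σ₁, hσ₁, hPl⟩ := hPl
  refine ⟨1, one_pos, ?_⟩
  intro a θ u ha hθ
  obtain ⟨σ₂, hσ₂, hsmall⟩ := exists_smallDensity uniformProfile one_pos
  refine ⟨min σ₁ σ₂, lt_min hσ₁ hσ₂, ?_⟩
  intro σ hσ hσlt Φ τ hτ χ hχ g hg hg0 ς hς
  have hsd : SmallDensity uniformProfile σ := (hsmall σ hσ (lt_of_lt_of_le hσlt (min_le_right _ _))).1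
  have hσ1 : σ < σ₁ := lt_of_lt_of_le hσlt (min_le_left _ _)
  refine ⟨1 / 4, by norm_num, ?_⟩
  intro r hr hr4 L κ hL hκ hκ1
  have hL0 : 0 < L := one_pos.trans_le hL
  have hr2 : r < 1 / 2 := hr4.trans (by norm_num)
  -- the constants
  obtain ⟨Cχ, hCχ, hχb⟩ := exists_pos_bound_on_strip hχ τ
  obtain ⟨Cg, hCg⟩ := exists_bound_of_vanishing hg hg0
  set Cp : ℝ := (3 + 4 * L * κ) ^ 3 with hCp
  set VL : ℝ := 4 / 3 * Real.pi * (1 + 2 * L * κ) ^ 3 with hVL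
  set K₁ : ℝ := 2 * (Cg * Cχ / κ) ^ 2 *
    (64 * L ^ 2 * Cp ^ 2 + 32 * (2 * L) ^ 2 * VL * σ ^ 3 + 192 * (2 * L) ^ 2 * VL ^ 2 * σ ^ 6) with hK₁
  set K₂ : ℝ := 2 * (Cg * Cχ / κ) ^ 2 * (8 * (2 * L) ^ 2 * VL ^ 2 * σ ^ 6) with hK₂
  set K₃ : ℝ := 2 * (2 * L * Cχ * Cp / κ) ^ 2 * 2 with hK₃
  set K₄ : ℝ := 2 * (2 * L * Cχ * Cp / κ) ^ 2 * (8 * Cg ^ 2) with hK₄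
  have hVL0 : 0 ≤ VL := by rw [hVL]; positivity
  have hK₁0 : 0 ≤ K₁ := by rw [hK₁]; positivity
  have hK₂0 : 0 ≤ K₂ := by rw [hK₂]; positivity
  have hK₃0 : 0 ≤ K₃ := by rw [hK₃]; positivity
  have hK₄0 : 0 ≤ K₄ := by rw [hK₄]; positivity
  have hς4 : 0 < ς / 4 := by positivity
  -- the small parameters
  obtain ⟨ζ, hζ, -, hζK⟩ := exists_pos_mul_le hK₂0 hς4
  obtain ⟨ζ', hζ', hζ'1, hζ'K⟩ := exists_pos_mul_le hK₃0 hς4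
  obtain ⟨δ, hδ, hmod⟩ := exists_modulus_at_cube hg hσ hζ'
  obtain ⟨η₄, hη₄, -, hη₄K⟩ := exists_pos_mul_le hK₄0 hς4
  -- the thresholds in `N`
  obtain ⟨N₂, hN₂⟩ := exists_hsDiameter_mul_lt σ (1 + 2 * L * κ)
  have hC1 : (1 : ℝ) ≤ 1 + 2 * L * κ := by nlinarith
  obtain ⟨N₃, hN₃⟩ := hPl σ hσ hσ1 (1 + 2 * L * κ) hC1 ζ hζ
  obtain ⟨N₄, hN₄⟩ := exists_posGibbs_sqDevEvent_le hsd one_pos hr hr2 hδ hη₄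
  obtain ⟨N₅, hN₅⟩ := exists_nat_div_succ_le K₁ hς4
  refine ⟨max (max (max 1 N₂) (max N₃ N₄)) N₅, fun N hN k l t ht => ?_⟩
  have hN1 : 1 ≤ N := le_trans (le_trans (le_trans (le_max_left _ _) (le_max_left _ _)) (le_max_left _ _)) hN
  have hN2' : N₂ ≤ N := le_trans (le_trans (le_trans (le_max_right _ _) (le_max_left _ _)) (le_max_left _ _)) hN
  have hN3' : N₃ ≤ N := le_trans (le_trans (le_trans (le_max_left _ _) (le_max_right _ _)) (le_max_left _ _)) hN
  have hN4' : N₄ ≤ N := le_trans (le_trans (le_trans (le_max_right _ _) (le_max_right _ _)) (le_max_left _ _)) hN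
  have hN5' : N₅ ≤ N := le_trans (le_max_right _ _) hN
  -- the weight `h = χ(t, ·)/C_χ` fed to the plateau
  have hhm : Measurable fun y : T3 => χ (t, y) / Cχ := (hχ.comp (Continuous.prodMk_right t)).measurable.div_const _
  have hh1 : ∀ y : T3, |χ (t, y) / Cχ| ≤ 1 := fun y => by
    rw [abs_div, abs_of_pos hCχ, div_le_one hCχ]; exact hχb t ht y
  -- the near-contact shell lies in the contact window of radius `(1 + 2Lκ) ε_N`
  have hDW : {d : T3 | hsDiameter σ N < ‖Torus.reprSym d‖ ∧ ‖Torus.reprSym d‖ ≤ hsDiameter σ N * (1 + 2 * L * κ)} ⊆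
      {d : T3 | Torus.euclidDist d 0 ≤ (1 + 2 * L * κ) * hsDiameter σ N} := fun d hd => by
    rw [mem_setOf_eq, Torus.euclidDist, sub_zero, mul_comm]
    exact hd.2
  have hdec := fun (i j i' j' : Fin (N + 1)) (hij : i ≠ j) (hii' : i ≠ i') (hij' : i ≠ j') (hji' : j ≠ i')
    (hjj' : j ≠ j') (hi'j' : i' ≠ j') (T T' : Set T3) (hT : MeasurableSet T) (hT' : MeasurableSet T')
    (hTD : T ⊆ {d : T3 | hsDiameter σ N < ‖Torus.reprSym d‖ ∧ ‖Torus.reprSym d‖ ≤ hsDiameter σ N * (1 + 2 * L * κ)})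
    (hT'D : T' ⊆ {d : T3 | hsDiameter σ N < ‖Torus.reprSym d‖ ∧ ‖Torus.reprSym d‖ ≤ hsDiameter σ N * (1 + 2 * L * κ)}) =>
    hN₃ N hN3' i j i' j' hij hii' hij' hji' hjj' hi'j' (fun y => χ (t, y) / Cχ) (fun y => χ (t, y) / Cχ) hhm hhm hh1 hh1
      T T' hT hT' (hTD.trans hDW) (hT'D.trans hDW)
  -- the Literature bound
  have hmain := variance_tubeStat_rung0_le_window hsd ha hθ u hN1 (Φ N) hχ hCχ t (hχb t ht) hg hCg k l hL0 hκ hr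
    (hN₂ N hN2') hζ.le hdec hζ'.le hδ hmod
  -- the four terms
  have h1 : K₁ / ((N + 1 : ℕ) : ℝ) ≤ ς / 4 := hN₅ N hN5'
  have h2 : K₂ * ζ ≤ ς / 4 := hζK
  have h3 : K₃ * ζ' ^ 2 ≤ ς / 4 := by
    have hsq : ζ' ^ 2 ≤ ζ' := by
      calc ζ' ^ 2 = ζ' * ζ' := sq ζ'
        _ ≤ ζ' * 1 := mul_le_mul_of_nonneg_left hζ'1 hζ'.le
        _ = ζ' := mul_one ζ'
    exact (mul_le_mul_of_nonneg_left hsq hK₃0).trans hζ'K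
  have h4 : K₄ * (posGibbsMeasure (fun _ : T3 => (1 : ℝ)) (hsDiameter σ N) (N + 1)).real (sqDevEvent (N + 1) δ r) ≤ ς / 4 :=
    (mul_le_mul_of_nonneg_left (hN₄ N hN4') hK₄0).trans hη₄K
  have hsum : 2 * (Cg * Cχ / κ) ^ 2 *
        ((64 * L ^ 2 * ((3 + 4 * L * κ) ^ 3) ^ 2 + 32 * (2 * L) ^ 2 * (4 / 3 * Real.pi * (1 + 2 * L * κ) ^ 3) * σ ^ 3 +
            192 * (2 * L) ^ 2 * (4 / 3 * Real.pi * (1 + 2 * L * κ) ^ 3) ^ 2 * σ ^ 6) / (N + 1 : ℕ) +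
          8 * ζ * (2 * L) ^ 2 * (4 / 3 * Real.pi * (1 + 2 * L * κ) ^ 3) ^ 2 * σ ^ 6) +
        2 * (2 * L * Cχ * (3 + 4 * L * κ) ^ 3 / κ) ^ 2 * (2 * ζ' ^ 2 + 8 * Cg ^ 2 *
          (posGibbsMeasure (fun _ : T3 => (1 : ℝ)) (hsDiameter σ N) (N + 1)).real (sqDevEvent (N + 1) δ r)) =
      K₁ / ((N + 1 : ℕ) : ℝ) + K₂ * ζ + K₃ * ζ' ^ 2 +
        K₄ * (posGibbsMeasure (fun _ : T3 => (1 : ℝ)) (hsDiameter σ N) (N + 1)).real (sqDevEvent (N + 1) δ r) := by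
    rw [hK₁, hK₂, hK₃, hK₄, hCp, hVL]; ring
  rw [hsum] at hmain
  linarith only [hmain, h1, h2, h3, h4]

/-- **(P-c) · RUNG 0 FROM THE WINDOWED PLATEAU** (registered stub `stub_rungZero_of_plateauWindow` of the skeleton of line
`liouville-continuity-pins-universal-contact-value`, crux `JParityClosure.EvenStressEnskog`, stmt-AtomisticToContinuum-13079;
registered here with the skeleton-local `PlateauWindow` unfolded, as `rungZero_of_plateauWindow`): the windowed plateau implies
`EvenStressEnskog` at constant profiles `(a, u, θ)`, unconditionally — the body of `EvenStressEnskog_rung0_of_plateau_contact`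
with the windowed tube variance `tubeVarianceRung0_of_plateauWindow` and the proved contact theorem
`HardSphereContactTheorem_holds`. [folklore] -/
theorem rungZero_of_plateauWindow :
    (∃ σ₁ : ℝ, 0 < σ₁ ∧ ∀ σ : ℝ, 0 < σ → σ < σ₁ → ∀ C : ℝ, 1 ≤ C → ∀ ζ : ℝ, 0 < ζ → ∃ N₀ : ℕ, ∀ N : ℕ, N₀ ≤ N →
      ∀ i j k l : Fin (N + 1), i ≠ j → i ≠ k → i ≠ l → j ≠ k → j ≠ l → k ≠ l →
      ∀ (h h' : T3 → ℝ), Measurable h → Measurable h' → (∀ y, |h y| ≤ 1) → (∀ y, |h' y| ≤ 1) →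
      ∀ T T' : Set T3, MeasurableSet T → MeasurableSet T' →
      T ⊆ {d | Torus.euclidDist d 0 ≤ C * hsDiameter σ N} → T' ⊆ {d | Torus.euclidDist d 0 ≤ C * hsDiameter σ N} →
      |(∫ x, h (x i) * T.indicator (fun _ => (1 : ℝ)) (x j - x i) * (h' (x k) * T'.indicator (fun _ => (1 : ℝ)) (x l - x k))
          ∂posGibbsMeasure (fun _ : T3 => (1 : ℝ)) (hsDiameter σ N) (N + 1)) -
        (∫ x, h (x i) * T.indicator (fun _ => (1 : ℝ)) (x j - x i)
          ∂posGibbsMeasure (fun _ : T3 => (1 : ℝ)) (hsDiameter σ N) (N + 1)) *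
        (∫ x, h' (x k) * T'.indicator (fun _ => (1 : ℝ)) (x l - x k)
          ∂posGibbsMeasure (fun _ : T3 => (1 : ℝ)) (hsDiameter σ N) (N + 1))|
        ≤ ζ * (volume T).toReal * (volume T').toReal) →
    ∃ η₀ : ℝ, 0 < η₀ ∧ ∀ (a θ : ℝ) (u : V3), 0 < a → 0 < θ → ∃ σ₀ : ℝ, 0 < σ₀ ∧ ∀ σ : ℝ, 0 < σ → σ < σ₀ →
      ∀ Φ : (N : ℕ) → HardSphereFlow (Torus.geometry (Fin 3)) (hsDiameter σ N) (N + 1),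
      ∀ τ : ℝ, 0 < τ → ∀ χ : ℝ × UnitAddTorus (Fin 3) → ℝ, Continuous χ → ∀ g : ℝ → ℝ, Continuous g →
      (∀ a, η₀ ≤ a → g a = 0) →
      ∀ η δ : ℝ, 0 < η → 0 < δ → ∃ r₀ : ℝ, 0 < r₀ ∧ ∀ r : ℝ, 0 < r → r < r₀ →
      ∃ N₀ : ℕ, ∀ N : ℕ, N₀ ≤ N → ∀ k l : Fin 3,
        localGibbsLaw σ (fun _ => a) (fun _ => u) (fun _ => θ) N (Φ N)
          {z | η < |evenStat σ N (Φ N) τ χ g (evenMark k l) r z|} ≤ ENNReal.ofReal δ :=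
  fun hPW =>
    EvenStressEnskog_rung0_of stub_velocityTruncationRung0
      (cylinderPullback_rung0_of_residuals stub_continuityCorrectionRung0 stub_shortFlightDeficitRung0
        stub_threeBodyCollisionSumRung0)
      (meanEnskogRung0_of_tubeMean_of_contactTheorem stub_tubeMeanRung0OfContact
        Literature.MathematicalPhysics.StatisticalMechanics.HardSphereContactTheorem_holds)
      (fixedTimeVariance_rung0_of_static (tubeVarianceRung0_of_plateauWindow hPW)
        (enskogRateVariance_rung0_static_of_flow stub_enskogRateVarianceRung0))

end Summit.AtomisticToContinuum.HydrodynamicLimit.Theorems.EvenStressEnskog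

end
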